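import Summits.BirchSwinnertonDyer.BirchSwinnertonDyer.Theorems.PrintCFramBottomClassIndexLawFiveLeEisensteinLambdaResidualBound
import Summits.BirchSwinnertonDyer.BirchSwinnertonDyer.Theorems.PrintCFramBottomClassIndexLawFiveLeEisensteinAnalyticSplit
import Literature.NumberTheory.EllipticCurves.ZpExtensionDecompositionAbovePProofs
import HarnessLib

/-!
# Route `PrintCFram`, crux C2 `BottomClassIndexLawFiveLe` (stmt-BirchSwinnertonDyer-20372), line `eisenstein-resource-bdp-line`,
# skeleton v4 (LEAD g4, sha16 fefbf6bba78d6cf1): the REGISTERED research stub `stub_analyticInequality_cmRamified` (= (AN)) BY NAME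
# ⟸ per-frame residual LINE DATA (kernel/print) ∧ (L) ∧ the Λ-adic CONGRUENCE (AN-cong) ∧ the CHARACTER residual inequality
# (cell `bsd-print-cfram`, width seat `bsd-line-cfram-p1-w2` g3; helper `--supports` 20372; ONE theorem, 0 facts, 0 definitions)

HONEST FRAMING. Nothing about BSD is proved; the stub is NOT closed. After LEAD g4's reshape v4 the registered stubs are `stub_prints`
(citations), `stub_residualCharacterSelmerFinite` (= the PRINT named fact `CastellaGrossiLeeSkinner2022.prop14_residualCharacterSelmer_finite`),
β1 `stub_flatEisensteinIncl_cmRamified` (research, no prover) and (AN) `stub_analyticInequality_cmRamified`: «at every ♭-BDP frame the first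
`λ(X_(∅,0)(W/K''_∞))` coefficients of `Q` are non-units». This file reduces (AN), SIGNATURE VERBATIM, to per-frame data of three kinds:

* LINE DATA at the frame (shape of CHL's devissage / LEAD g4's `…IsogenyLineData`, KERNEL on the CM-ramified class except the two residual
  finiteness conjuncts, which are CGLS Prop. 14 = the print stub): a set `S ⊇` the bad places prime to `p`, a `Γ_{K''}`-stable line
  `Φ ≤ W[p]` with `(W[p]/Φ)^{G_{K''_{∞,𝔭'}}} = 0`, (L) «`W[p^∞]^{G_{K''_{∞,𝔭'}}}` has no `p`-torsion» (on this class ⟸ `W(ℚ_p)[p] = 0`), and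
  `R_𝔭'^S(K''_∞, Φ)`, `R_𝔭'^S(K''_∞, W[p]/Φ)` finite;
* (AN-cong): a unit `u` and `L₁, L₂ ∈ 𝓞_{ℂ_p}⟦T⟧` with `Q ≡ u·L₁·L₂ (mod 𝔪)` coefficientwise — the Λ-adic Eisenstein / Kriz–Li-type congruence of
  `L_𝔭^{BDP}(f_W/K'')` with the product of the two character `p`-adic `L`-functions (RESEARCH at `p² ∣ N`; Kriz–Li 2019 §7 proves the
  congruences for all `θ^j`-twists without good reduction at `p`);
* (AN-λ-res): `log_p(#R(Φ) · #R(W[p]/Φ)) ≤ ord L̄₁ + ord L̄₂` — the two CHARACTER-LEVEL residual inequalities (quantitative CGLS Prop. 14: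
  Rubin's divisibility + Hida `μ = 0` + no finite submodule for the character Iwasawa modules over `K''`; PRINT-level for characters).
Proof: `p^{λ(X_(∅,0))} ≤ #R(Φ)·#R(W[p]/Φ)` (`LambdaResidualBound.pow_lambdaInvariant_empty_le_mul_natCard_residualSelmer_of_line`; Brink's
`D_{𝔭'} ⊄ ker κ` discharged by `ZpExtension.not_decomp_le_kerSubgroup_of_isImaginaryQuadratic`), so `λ ≤ log_p(…) ≤ ord L̄₁ + ord L̄₂`,
then `EisensteinMatchAnatomy.coeff_norm_lt_one_of_congr_of_le_order`. So the ONLY elliptic-curve statement left inside (AN) is the congruence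
(AN-cong). BSD is not proved by any of this; no summit statement is proved by this seat.

References: Castella–Grossi–Lee–Skinner 2022 §3 Thm. 3.2.1, Props. 14, 17, 18 [CastellaGrossiLeeSkinner2022]; Greenberg–Vatsal 2000 Thm. (1.3),
(17), Prop. (2.8) [GreenbergVatsal2000]; Kriz–Li 2019 Thm. 1.12, §7 [KrizLi2019]; Rubin 1991 Thm. 4.1 [Rubin1991MainConj]; Brink 2007 Thm. 2
[Brink2007].
-/

set_option autoImplicit false
-- the summit namespace `Summit.BirchSwinnertonDyer.BirchSwinnertonDyer` repeats the problem name by design (D-0017)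
set_option linter.dupNamespace false

noncomputable section

open scoped Classical

namespace Summit.BirchSwinnertonDyer.BirchSwinnertonDyer.Theorems.PrintCFram.LambdaResidualBound

open WeierstrassCurve NumberField IsDedekindDomain Field PowerSeries IsLocalRing
  Literature.NumberTheory.EllipticCurves Literature.NumberTheory.EllipticCurves.GreenbergSelmer
  Literature.NumberTheory.EllipticCurves.GreenbergVatsal2000
  Literature.NumberTheory.EllipticCurves.ModularForms
  Literature.NumberTheory.EllipticCurves.Rank1Residual
  Literature.NumberTheory.EllipticCurves.Rank1Residual.Typed
  Literature.NumberTheory.EllipticCurves.IwasawaAlgebra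
  Literature.NumberTheory.GaloisRepresentations
  Summit.BirchSwinnertonDyer.Rank1Residual
  Summit.BirchSwinnertonDyer.Rank1Residual.X11b Summit.BirchSwinnertonDyer.Rank1Residual.X11b.AcSelmer
  Summit.BirchSwinnertonDyer.Rank1Residual.X2.ResidualDevissageModules
  Summit.BirchSwinnertonDyer.BirchSwinnertonDyer.Theorems
  Summit.BirchSwinnertonDyer.BirchSwinnertonDyer.Theorems.SchneiderFree
  Summit.BirchSwinnertonDyer.BirchSwinnertonDyer.Theorems.PrintCFram.EisensteinMatchAnatomy

/-- **REGISTERED `stub_analyticInequality_cmRamified` (v4, signature verbatim) ⟸ line data ∧ (L) ∧ (AN-cong) ∧ (AN-λ-res) at every frame.**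
At each ♭-BDP frame of a CM-ramified `W` (`p ≥ 5`, `r_an = 1`) over a Heegner field `K` with anticyclotomic `κ` and primes `𝔭 ≠ 𝔭'` over
`p`, the hypothesis supplies: a set `S` (good reduction outside `S` away from `p`), a `Γ_K`-stable `Φ ≤ W_K[p]` with no non-zero
`ker κ ⊓ D_{𝔭'}`-fixed vector in `W_K[p]/Φ`, (L) no `p`-torsion in `W_K[p^∞]^{ker κ ⊓ D_{𝔭'}}`, finite residual Selmer groups
`R_{𝔭'}^S(K_∞, Φ)`, `R_{𝔭'}^S(K_∞, W_K[p]/Φ)`, a unit `u` and `L₁ L₂ ∈ 𝓞_{ℂ_p}⟦T⟧` with `Q ≡ u·L₁·L₂ (mod 𝔪)`, and the residual inequality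
`log_p(#R(Φ)·#R(W_K[p]/Φ)) ≤ ord L̄₁ + ord L̄₂`. Conclusion: the first `λ(X_(∅,0)(W_K/K_∞))` coefficients of `Q` have norm `< 1`. CONDITIONAL
on the displayed per-frame data; closes nothing. [cite: CastellaGrossiLeeSkinner2022, §3 Thm. 3.2.1 and Props. 14, 17, 18 (arXiv:2008.02571)]
[cite: GreenbergVatsal2000, Thm. (1.3) and (17)] [cite: Brink2007, Thm. 2] -/
theorem stub_analyticInequality_cmRamified_of_lineData_of_congruence
    (hdata : ∀ (p : ℕ) [Fact p.Prime] (W : WeierstrassCurve ℚ) [W.IsElliptic] [W.IsGloballyMinimal],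
      W.HasCM → CMRamified W p → 5 ≤ p → W.analyticRank = 1 →
      ∀ (N : ℕ) [NeZero N] (K : Type) [Field K] [NumberField K] (Dt : ModularParametrizationData W N),
      W.conductorNorm ℤ = N → IsImaginaryQuadratic K → SatisfiesHeegnerHypothesis N K →
      ∀ (κ : ZpExtension K p), κ.IsAnticyclotomic → ∀ (γ : Field.absoluteGaloisGroup K) [Fact (κ.IsTopGenerator γ)]
        (𝔭 : HeightOneSpectrum (𝓞 K)), ((p : ℕ) : 𝓞 K) ∈ 𝔭.asIdeal → 𝔭.asIdeal.ramificationIdx (𝓞 ℚ) = 1 →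
        𝔭.asIdeal.inertiaDeg (𝓞 ℚ) = 1 → ∀ (𝔭' : HeightOneSpectrum (𝓞 K)), ((p : ℕ) : 𝓞 K) ∈ 𝔭'.asIdeal → 𝔭' ≠ 𝔭 →
        ∀ (ι' : PadicAlgCl p ≃+* ℂ), SchneiderFree.BranchInducesPrime p ι' 𝔭 →
        ∀ (ΩK : ℂ) (Ωp : ℂ_[p]) (Q : PowerSeries (PadicComplexInt p)), ΩK ≠ 0 → Ωp ≠ 0 →
          R1.IsBDPLFunctionInt p ι' 𝔭 κ γ Dt.f ΩK Ωp Q →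
          ∃ (S : Set (HeightOneSpectrum (𝓞 K)))
            (Φ : StableSubgroup (absoluteGaloisGroup K) ((W.baseChange K).geomTorsion (p : ℤ)))
            (u L₁ L₂ : PowerSeries (PadicComplexInt p)),
            (∀ v : HeightOneSpectrum (𝓞 K), v ∉ S → ((p : ℕ) : 𝓞 K) ∉ v.asIdeal → (W.baseChange K).HasGoodReductionAt v) ∧
            (∀ y : Φ.Quot, (∀ g : ↥(κ.kerSubgroup ⊓ decomp 𝔭'), g • y = y) → y = 0) ∧
            (∀ m : (W.baseChange K).geomPrimaryTorsion p,
              (∀ σ ∈ κ.kerSubgroup ⊓ decomp 𝔭', σ • m = m) → p • m = 0 → m = 0) ∧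
            (datumStrictSelmer κ.kerSubgroup Φ.Sub p (AcSelmer.bdpData Φ.Sub p 𝔭') S :
              Set (subgroupH1 κ.kerSubgroup Φ.Sub)).Finite ∧
            (datumStrictSelmer κ.kerSubgroup Φ.Quot p (AcSelmer.bdpData Φ.Quot p 𝔭') S :
              Set (subgroupH1 κ.kerSubgroup Φ.Quot)).Finite ∧
            IsUnit u ∧
            (∀ n, PowerSeries.coeff n Q - PowerSeries.coeff n (u * L₁ * L₂) ∈ maximalIdeal (PadicComplexInt p)) ∧
            ((Nat.log p (Nat.card (datumStrictSelmer κ.kerSubgroup Φ.Sub p (AcSelmer.bdpData Φ.Sub p 𝔭') S) *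
                Nat.card (datumStrictSelmer κ.kerSubgroup Φ.Quot p (AcSelmer.bdpData Φ.Quot p 𝔭') S)) : ℕ) : ℕ∞) ≤
              (PowerSeries.map (residue (PadicComplexInt p)) L₁).order +
                (PowerSeries.map (residue (PadicComplexInt p)) L₂).order) :
    ∀ (p : ℕ) [Fact p.Prime] (W : WeierstrassCurve ℚ) [W.IsElliptic] [W.IsGloballyMinimal],
      W.HasCM → CMRamified W p → 5 ≤ p → W.analyticRank = 1 →
      ∀ (N : ℕ) [NeZero N] (K : Type) [Field K] [NumberField K] (Dt : ModularParametrizationData W N),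
      W.conductorNorm ℤ = N → IsImaginaryQuadratic K → SatisfiesHeegnerHypothesis N K →
      ∀ (κ : ZpExtension K p), κ.IsAnticyclotomic → ∀ (γ : Field.absoluteGaloisGroup K) [Fact (κ.IsTopGenerator γ)]
        (𝔭 : HeightOneSpectrum (𝓞 K)), ((p : ℕ) : 𝓞 K) ∈ 𝔭.asIdeal → 𝔭.asIdeal.ramificationIdx (𝓞 ℚ) = 1 →
        𝔭.asIdeal.inertiaDeg (𝓞 ℚ) = 1 → ∀ (𝔭' : HeightOneSpectrum (𝓞 K)), ((p : ℕ) : 𝓞 K) ∈ 𝔭'.asIdeal → 𝔭' ≠ 𝔭 →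
        ∀ (ι' : PadicAlgCl p ≃+* ℂ), SchneiderFree.BranchInducesPrime p ι' 𝔭 →
        ∀ (ΩK : ℂ) (Ωp : ℂ_[p]) (Q : PowerSeries (PadicComplexInt p)), ΩK ≠ 0 → Ωp ≠ 0 →
          R1.IsBDPLFunctionInt p ι' 𝔭 κ γ Dt.f ΩK Ωp Q →
          ∀ m < lambdaInvariant p (XAc (W.baseChange K) p κ 𝔭' ∅ γ),
            ‖((PowerSeries.coeff m Q : PadicComplexInt p) : ℂ_[p])‖ < 1 := by
  intro p _ W _ _ hCM hram h5 hr N _ K _ _ Dt hN hK hHN κ hκ γ _ 𝔭 h𝔭 he hf 𝔭' h𝔭' hne ι' hind ΩK Ωp Q hΩK hΩp hBDP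
  obtain ⟨S, Φ, u, L₁, L₂, hSgood, hfix, hL, hΦ, hΨ, hu, hcong, hres⟩ :=
    hdata p W hCM hram h5 hr N K Dt hN hK hHN κ hκ γ 𝔭 h𝔭 he hf 𝔭' h𝔭' hne ι' hind ΩK Ωp Q hΩK hΩp hBDP
  haveI hEK : (W.baseChange K).IsElliptic := inferInstanceAs (W.map (algebraMap ℚ K)).IsElliptic
  have hpr : p.Prime := Fact.out
  have hp2 : p ≠ 2 := by omega
  have h𝔭dec : ¬ (decomp 𝔭' ≤ κ.kerSubgroup) :=
    ZpExtension.not_decomp_le_kerSubgroup_of_isImaginaryQuadratic hK κ (by exact_mod_cast h𝔭')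
  -- `p^{λ} ≤ #R(Φ) · #R(W[p]/Φ)`
  have hlam := pow_lambdaInvariant_empty_le_mul_natCard_residualSelmer_of_line (W.baseChange K) p κ 𝔭' γ hp2 h𝔭' h𝔭dec
    hSgood Φ hfix hL hΦ hΨ
  -- hence `λ ≤ log_p(#R(Φ) · #R(W[p]/Φ)) ≤ ord L̄₁ + ord L̄₂`
  have hle : ((lambdaInvariant p (XAc (W.baseChange K) p κ 𝔭' ∅ γ) : ℕ) : ℕ∞) ≤
      (PowerSeries.map (residue (PadicComplexInt p)) L₁).order + (PowerSeries.map (residue (PadicComplexInt p)) L₂).order :=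
    le_trans (by exact_mod_cast Nat.le_log_of_pow_le hpr.one_lt hlam) hres
  exact coeff_norm_lt_one_of_congr_of_le_order hu hcong hle

end Summit.BirchSwinnertonDyer.BirchSwinnertonDyer.Theorems.PrintCFram.LambdaResidualBound

end
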